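import Summits.QuantumFields.BalabanUV.Beta.EriceFlowEnclosureB12AsPrintedPointwiseFadingSignFamily
import Summits.QuantumFields.BalabanUV.Beta.EriceFlowEnclosureB12AsPrintedHistoryNonuniqueForward
import Summits.QuantumFields.BalabanUV.Beta.EriceFlowEnclosureB12AsPrintedLastVar

/-!
# Beta / EriceFlowEnclosureB12AsPrintedPointwiseFadingSignWitness — WHAT (0.31) FORCES POINTWISE, witness part 8b: THE RAMP SETTING and the headline — UNDER FADING
# MEMORY THE TYPED THEOREM 2 DOES NOT FORCE THE SIGN OF β.  A def-free `B12BetaAsPrinted.Setting` of [I] as typed carrying part 8a's ramp family (β_1 ≡ 1, β_2(g₀, g₁) =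
# g₁(2g₁ − g₀), β_{k+1} ≡ 1 for k ≥ 2; runs = the forward solutions of (0.20), prover 1's forward table `…HistoryNonuniqueForward`; kernels β_{j+1}·Re Qᵀ via prover 1's #60d
# toolkit; the interaction slot 𝐄_int := β − 1 VANISHES IN ITS HISTORY DEPENDENCE on the face g_k = 0, (2.13)'s remark, because β_2(g₀, 0) = 0): `StandingHypotheses ∧ Definitions ∧
# Conclusions` hold (so `B12BetaAsPrinted S`), THEOREM 2 AS TYPED holds (part 8a), node U2's coupling-chart moduli `HistLipschitz Λ (1∕2)` with `FadingMemory 5 (1∕2) Λ` hold, (U), (C),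
# p. 264's clause, `hrg` hold, «g₀ = g₀(ε, g)» is a function near zero (part 7, free) — and ¬`FlowStep.BetaSignH` (β_2(δ, δ∕3) = −δ²∕9 inside every box), ¬(the g-uniform form of
# (0.31)).  HEADLINE **`sign_not_forced_by_typed_theorem2_fadingMemory`**, and as a schema **`not_betaSignH_of_theorem2_fadingMemory_schema`**: part 5's `betaSignH_of_theorem2_unique_markov`
# (#60a: typed Theorem 2 + `Definitions` + `hrg` + (U) + local uniqueness + MARKOV ⟹ `BetaSignH`) with its Markov letter replaced by node U2's fading-memory moduli is FALSE — the Markov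
# letter is load-bearing for the SIGN in the typed reading, even though uniqueness comes for free; what the typed Theorem 2 does force under the moduli is part 8's
# `negPart_of_theorem2_fadingMemory` (β_{k+1} ≥ −(C∕(1−θ))δ on ]0, δ]^{k+1})
# (β-flow team, prover 2 = lower ∕ positivity side, unit `b2b-balaban-beta-bflow-p2`, gen 44; ROW AP-I × node U2's letters)

HONEST FRAMING (page 1 of everything the β sub-cell writes): discharging `BetaPertH` makes Bałaban's UV stability UNCONDITIONAL — a
real constructive-QFT result; it is NOT the continuum limit and NOT the Clay problem.  HONEST DEPENDENCY (cell reorg 2026-08-19,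
verbatim): «continuum YM on T⁴ ⇐ BetaPertH ∧ nine spine estimates (0/9 proved); BetaPertH ⇐ (D1) ∧ (D4) ∧ CAP+tail; G-an2-4 gates
asym, D1 and NE2/3/4.»  THIS MODULE DISCHARGES NOTHING and says NOTHING about Bałaban's objects: ONE toy setting (ours) of the typing `B12BetaAsPrinted` ([I] = T. Bałaban, Commun.
Math. Phys. **109** (1987) [Balaban1987RG1] as typed, p537882 ✓ ∕ v1.1–v1.3), slots filled with prover 1's toy kernels; `Theorem2Statement` (STATED WITHOUT PROOF in print, p. 259) is
PROVED FOR THE TOY; node U2's `HistLipschitz` ∕ `FadingMemory` (NOT printed; GAPS G-t4-U2-2) are VERIFIED for the toy.  Uniqueness of g₀ is NOT printed in [I] (DELTA-I D-21).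

WHAT THIS FILE PROVES (0 sorry, 0 def): **`rampToy_exists`** (the setting), **`sign_not_forced_by_typed_theorem2_fadingMemory`** (everything of [I] as typed + Theorem 2 as typed + the moduli +
(U)(C)(264) `hrg` + uniqueness near zero, yet ¬`BetaSignH` and ¬ the uniform form), **`not_betaSignH_of_theorem2_fadingMemory_schema`**.
NOT CLAIMED: that the toy resembles Bałaban's β; which reading print intends; Theorem 2; `BetaPertH`; continuum; Clay.
-/

namespace Summit.QuantumFields.BalabanUV.Beta.EriceFlowEnclosureB12AsPrintedPointwiseFadingSignWitness

open Finset
open Literature.MathematicalPhysics.QuantumFieldTheory.GawedzkiKupiainen1985.PeriodicGleason (Pt ExpBound)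
open Literature.MathematicalPhysics.QuantumFieldTheory.Balaban1983to89
open Literature.MathematicalPhysics.QuantumFieldTheory.Balaban1983to89.B12Rep537 (wilsonQ MQ)
open Literature.MathematicalPhysics.QuantumFieldTheory.Balaban1983to89.B12BetaAsPrinted
open Literature.MathematicalPhysics.QuantumFieldTheory.Balaban1983to89.FlowStep (HBeta prefixOf Box mem_box box_mono RGEqH BetaLowerH
  BetaUpperH BetaContH BetaSignH)
open Literature.MathematicalPhysics.QuantumFieldTheory.Balaban1983to89.T4CouplingMatching (HistLipschitz FadingMemory)
open Literature.MathematicalPhysics.QuantumFieldTheory.Balaban1983to89.B12CouplingClausesHistory (BetaSmoothInLast264 betaDerivsBoundedInLast264_of_smooth)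
open Summit.QuantumFields.BalabanUV.Beta.EriceFlowEnclosureB12AsPrintedMarginal (wilsonQ_perm wilsonQ_neg_transpose)
open Summit.QuantumFields.BalabanUV.Beta.EriceFlowEnclosureB12AsPrintedWitness (secondMoment_toyKernel fourier_toyKernel
  decay510_toyKernel reflect_toyKernel rep537_toyKernel)
open Summit.QuantumFields.BalabanUV.Beta.EriceFlowEnclosureB12AsPrintedLastVar (rep537_diag expBound_zero)
open Summit.QuantumFields.BalabanUV.Beta.EriceFlowEnclosureB12AsPrintedHistoryNonuniqueForward (fwd_d020 fwd_eq_of_rgEqH)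
open Summit.QuantumFields.BalabanUV.Beta.EriceFlowEnclosureB12AsPrintedPointwiseFadingSignFamily

noncomputable section

/-! ## §1 The ramp setting -/

/-- **THE RAMP TOY** (fields as prover 1's #62f `nonuniqueToy_exists`): L = 13, γ = ½, β = part 8a's ramp family, runs = the forward solutions of (0.20) (forward table), 𝐄_int := β − 1
(vanishes in its history dependence on the face g_k = 0: β_2(g₀, 0) = 0), kernels β_{j+1}·Re Q_{νμ}; `StandingHypotheses ∧ Definitions ∧ Conclusions` of [I] as typed hold (|β_{j+1}| ≤ 1 on
the sections over [0, ½] feeds (1.18) and (5.44); p. 264's clause via part 8a's `letters_ramp`). [folklore] -/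
theorem rampToy_exists :
    ∃ S : Setting, StandingHypotheses S ∧ Definitions S ∧ Conclusions S ∧ S.γ = 1 / 2 ∧
      ∀ (k : ℕ) (p : Fin (k + 1) → ℝ), S.β k p = if k = 1 then p (Fin.last k) * (2 * p (Fin.last k) - p 0) else 1 := by
  -- `Setting` fields in order: L, groupScope, ε₀, cpl, β, γ, M, κ, Cfg, one, logZ, Eint, Ebold, repr437, α₀, α₁, E₀, Mκ, pol, polIV, κ₀,
  -- indAss, ε₁, altCutoff266, logN2, δ₀, δ₁, C510, C544 (anonymous constructor).
  let βt : HBeta := fun k p => if k = 1 then p (Fin.last k) * (2 * p (Fin.last k) - p 0) else 1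
  have hβ : ∀ (k : ℕ) (p : Fin (k + 1) → ℝ), βt k p = if k = 1 then p (Fin.last k) * (2 * p (Fin.last k) - p 0) else 1 :=
    fun _ _ => rfl
  let tbl : ℝ → ℕ → ℕ → ℝ := fun g₀ => fun k => Nat.rec (motive := fun _ => ℕ → ℝ) (fun _ => g₀)
      (fun k t i => if i ≤ k then t i else 1 / Real.sqrt (1 / (t k) ^ 2 - βt k (fun j : Fin (k + 1) => t j))) k
  have hcs : ∀ (g₀ : ℝ) (k i : ℕ), tbl g₀ (k + 1) i =
      if i ≤ k then tbl g₀ k i else 1 / Real.sqrt (1 / (tbl g₀ k k) ^ 2 - βt k (fun j : Fin (k + 1) => tbl g₀ k j)) := fun g₀ k i => rfl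
  let S : Setting := ⟨13, True, 1, fun P k => tbl P.g0 k k, βt, 1 / 2, 1, 1, fun _ => Unit, fun _ => (), fun _ _ => 1,
      fun k p _ => βt k p - 1, fun k p _ => βt k p, fun _ F E => |F ()| ≤ E, 1, 1, 2, fun _ => 1,
      fun _ F => fun μ ν x => F () * (wilsonQ ν μ x).re, fun k p => fun μ ν x => βt k p * (wilsonQ ν μ x).re, 1, fun _ _ => True, 1, False,
      fun k p => βt k p - 1, 1, 1, MQ 1 4, 1⟩
  have hβS : ∀ (k : ℕ) (p : Fin (k + 1) → ℝ), S.β k p = if k = 1 then p (Fin.last k) * (2 * p (Fin.last k) - p 0) else 1 := hβ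
  have hH : StandingHypotheses S :=
    { hL := ⟨⟨6, rfl⟩, by show (11 : ℕ) < 13; norm_num⟩, hG := trivial, hκ₀ := by norm_num, hMκ := by norm_num,
      hγ := by show (0 : ℝ) < 1 / 2; norm_num,
      hε₀ := by norm_num, hε₁ := by norm_num, hα₀ := by norm_num, hα₁ := by norm_num, hκ := le_rfl, hM := le_rfl }
  -- the size of the slots on the printed coupling domain of the sections: |β| ≤ 1, |𝐄_int| ≤ 2
  have hsz : ∀ P : B12.RunParams, RunHyp S P → ∀ j : ℕ, j + 1 ≤ P.K → ∀ s ∈ Set.Icc (0 : ℝ) (1 / 2),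
      |βt j (sectionHist S P j s)| ≤ 1 ∧ |βt j (sectionHist S P j s) - 1| ≤ 2 := by
    intro P hP j hj s hs
    have hdom := sectionHist_mem_histDom hP.inInterval hj hs
    have hl : 0 ≤ sectionHist S P j s (Fin.last j) ∧ sectionHist S P j s (Fin.last j) ≤ 1 / 2 := hdom.2
    have h0 : 0 ≤ sectionHist S P j s 0 ∧ sectionHist S P j s 0 ≤ 1 / 2 := by
      by_cases he : (0 : Fin (j + 1)) = Fin.last j
      · rw [he]; exact hl
      · exact ⟨(hdom.1 0 he).1.le, (hdom.1 0 he).2⟩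
    have h1 : |βt j (sectionHist S P j s)| ≤ 1 := abs_beta_le_one (S := S) hβS h0.1 h0.2 hl.1 hl.2
    refine ⟨h1, ?_⟩
    have h2 := abs_le.mp h1
    exact abs_le.mpr ⟨by linarith, by linarith⟩
  have hD : Definitions S := by
    refine { d018 := fun P => rfl, d020 := ?_, d13 := ?_, d213 := ?_, d214 := fun _ _ => rfl, d120 := fun _ _ => rfl,
             d120split := ?_, d121 := ?_, d122 := ?_ }
    · intro P k _ _ h
      exact fwd_d020 (β := βt) (c := tbl P.g0) (hcs P.g0) k h
    · intro j p U
      have h1 : S.Ebold j p U = S.Ebold j p (S.one (j + 1)) := rfl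
      have h2 : S.logZ j U = S.logZ j (S.one (j + 1)) := rfl
      have h3 : S.Eint j p U = S.Eint j p (S.one (j + 1)) := rfl
      rw [h1, h2, h3, sub_self, sub_self, sub_self, add_zero]
    · intro k p p' hp hp'
      show (fun _ : Unit => βt k p - 1) = fun _ : Unit => βt k p' - 1
      simp only [hβ, hp, hp', zero_mul]
    · intro j p; funext μ ν x; simp only [Pi.add_apply]; ring
    · intro k p
      refine ⟨fun σ μ ν x => congrArg (fun r : ℝ => βt k p * r) (congrArg Complex.re (wilsonQ_perm σ ν μ x)),
        fun ε' hε' μ ν z => reflect_toyKernel _ hε' μ ν z,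
        fun μ ν z => congrArg (fun r : ℝ => βt k p * r) (congrArg Complex.re (wilsonQ_neg_transpose ν μ z).symm)⟩
    · intro j p _ μ ν hμν
      exact ⟨(fourier_toyKernel hμν _).symm, (secondMoment_toyKernel hμν _).symm⟩
  have hSm : BetaSmoothInLast264 S.γ S.β := (letters_ramp (S := S) hβS).2.2.1 (1 / 2)
  have hCo : Conclusions S := by
    refine { c13 := fun _ _ _ _ => trivial, c118 := fun P hP j hj s hs => ⟨?_, ?_⟩, c264 := ?_, c510 := ?_, c537 := ?_ }
    · exact (hsz P hP j hj s hs).1.trans (by norm_num)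
    · exact (hsz P hP j hj s hs).2
    · intro P hP j hj
      exact ⟨fun m => smooth264_of_box hSm hP.inInterval hj m, fun h => h.elim,
        fun m => derivBound264_of_box (betaDerivsBoundedInLast264_of_smooth hH.hγ hSm) hP.inInterval hj m⟩
    · refine ⟨by norm_num, fun j F E hF μ ν x => ?_⟩
      have hF' : |F ()| ≤ E := hF
      have hd := decay510_toyKernel (d := 4) (F ()) μ ν x
      have hMQ := B12Rep537.MQ_nonneg 1 4
      show |F () * (wilsonQ ν μ x).re| ≤ MQ 1 4 * E * Real.exp (-1 * B12Sec2to5.l1 x)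
      calc |F () * (wilsonQ ν μ x).re| ≤ |F ()| * MQ 1 4 * Real.exp (-1 * B12Sec2to5.l1 x) := hd
        _ ≤ E * MQ 1 4 * Real.exp (-1 * B12Sec2to5.l1 x) := by gcongr
        _ = MQ 1 4 * E * Real.exp (-1 * B12Sec2to5.l1 x) := by ring
    · intro P hP j hj s hs μ ν
      by_cases hμν : μ = ν
      · subst hμν
        exact ⟨fun _ _ => 0, fun x => rep537_diag _ μ x, fun w => expBound_zero _ _ (by positivity)⟩
      · obtain ⟨rem, hrep, hdec⟩ := rep537_toyKernel (d := 4) hμν (βt j (sectionHist S P j s)) (1 / 2)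
        refine ⟨rem, hrep, fun w => (hdec w).mono ?_⟩
        show |βt j (sectionHist S P j s)| ≤ 1 * 2
        rw [one_mul]; exact (hsz P hP j hj s hs).1.trans (by norm_num)
  exact ⟨S, hH, hD, hCo, rfl, hβS⟩

/-! ## §2 Headline -/

/-- **UNDER FADING MEMORY THE TYPED THEOREM 2 DOES NOT FORCE THE SIGN OF β.**  There is a setting of [I] as typed with the standing hypotheses, the printed `Definitions` and
`Conclusions` (so `B12BetaAsPrinted S`), THEOREM 2 AS TYPED (`Theorem2Statement`), node U2's coupling-chart moduli `HistLipschitz Λ (1∕2) S.β` with `FadingMemory 5 (1∕2) Λ`, the upper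
letter (U) `BetaUpperH 1 (1∕2)`, (C), p. 264's clause box-wide, prover 1's binder `hrg` on ]0, ½], and «g₀ = g₀(ε, g)» a FUNCTION near zero (for every m some ]0, g₂] with unique bare
couplings — part 7, free) — whose β_2 is NEGATIVE inside every box (¬`BetaSignH`) and whose (0.31) admits NO g-uniform constants.  In the Markov reading the typed Theorem 2 DOES force
the sign (part 1 #59a `betaSignH_of_theorem2_markov`, part 5 #60a `betaSignH_of_theorem2_unique_markov`); in the history reading with fading memory it forces only β ≥ −(C∕(1−θ))δ on
]0, δ]^{k+1} (part 8 `negPart_of_theorem2_fadingMemory`). [cite: Balaban1987RG1, Thm 2 (0.31) p.259 with (0.20) p.256 and p.298] -/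
theorem sign_not_forced_by_typed_theorem2_fadingMemory :
    ∃ (S : Setting) (hH : StandingHypotheses S), Definitions S ∧ Conclusions S ∧ B12BetaAsPrinted S ∧ Theorem2Statement S (hL_of_standing hH) ∧
      (HistLipschitz (fun k _ => if k = 1 then 5 * (1 / 2 : ℝ) else 0) (1 / 2) S.β ∧
        FadingMemory (5 * (1 / 2) / (1 / 2)) (1 / 2) (fun k _ => if k = 1 then 5 * (1 / 2 : ℝ) else 0)) ∧
      BetaUpperH 1 (1 / 2) S.β ∧ BetaContH (1 / 2) S.β ∧ BetaSmoothInLast264 (1 / 2) S.β ∧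
      (∀ P : B12.RunParams, Step.InInterval (1 / 2) P.K (S.cpl P) → RGEqH P.K S.β (S.cpl P)) ∧
      (∀ m : ℕ, ∃ g₂ : ℝ, 0 < g₂ ∧ ∀ (K : ℕ) (g₀ g₀' : ℝ), Step.InInterval g₂ K (S.cpl ⟨K, m, g₀⟩) →
        Step.InInterval g₂ K (S.cpl ⟨K, m, g₀'⟩) → S.cpl ⟨K, m, g₀⟩ K = S.cpl ⟨K, m, g₀'⟩ K → g₀ = g₀') ∧
      ¬ BetaSignH S.β ∧
      ¬ ∀ m : ℕ, ∃ γ₀ : ℝ, 0 < γ₀ ∧ ∀ γ : ℝ, 0 < γ → γ ≤ γ₀ → ∃ g₁ : ℝ, 0 < g₁ ∧ ∃ β β' : ℝ, 0 < β ∧ β ≤ β' ∧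
        ∀ g : ℝ, 0 < g → g ≤ g₁ → ∀ K : ℕ, ∃ g₀ : ℝ, Step.InInterval γ K (S.cpl ⟨K, m, g₀⟩) ∧ S.cpl ⟨K, m, g₀⟩ K = g ∧
          Step.Discrete031 (β * Real.log S.L) (β' * Real.log S.L) K g (S.cpl ⟨K, m, g₀⟩) := by
  obtain ⟨S, hH, hD, hC, hγ, hβ⟩ := rampToy_exists
  obtain ⟨hU, hcont, hsm, hrg⟩ := letters_ramp hβ
  exact ⟨S, hH, hD, hC, fun _ _ => hC, theorem2_typed_ramp hβ hH hD,
    ⟨histLipschitz_ramp hβ (by norm_num), fadingMemory_ramp (by norm_num) (by norm_num) (by norm_num)⟩,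
    hU, hcont _, hsm _, hrg hD, fun m => localUnique_ramp hβ hD m, not_betaSignH_ramp hβ, not_uniform_ramp hβ hD (hL_of_standing hH).2⟩

/-- **PART 5's SIGN THEOREM WITH THE MARKOV LETTER REPLACED BY FADING MEMORY IS FALSE — AS A SCHEMA.**  «Theorem 2 as typed + the printed `Definitions` and `Conclusions` + node U2's
coupling-chart moduli `HistLipschitz Λ γ_U S.β`, `FadingMemory C θ Λ` (0 ≤ θ < 1) + (U) + prover 1's binder `hrg` ⟹ `BetaSignH S.β`» fails: the ramp setting.  (Part 5's
`betaSignH_of_theorem2_unique_markov` has the Markov letter AND local uniqueness; here local uniqueness holds — part 7 — and only the Markov letter is missing: it is load-bearing.)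
[cite: Balaban1987RG1, Thm 2 (0.31) p.259 with p.298] -/
theorem not_betaSignH_of_theorem2_fadingMemory_schema :
    ¬ ∀ (S : Setting) (hH : StandingHypotheses S), Definitions S → Conclusions S → Theorem2Statement S (hL_of_standing hH) →
      ∀ (Λ : ℕ → ℕ → ℝ) (γU θ C M : ℝ), 0 < γU → 0 ≤ θ → θ < 1 → 0 ≤ C →
        HistLipschitz Λ γU S.β → FadingMemory C θ Λ → BetaUpperH M γU S.β →
        (∀ P : B12.RunParams, Step.InInterval γU P.K (S.cpl P) → RGEqH P.K S.β (S.cpl P)) → BetaSignH S.β := by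
  intro h
  obtain ⟨S, hH, hD, hC, hγ, hβ⟩ := rampToy_exists
  obtain ⟨hU, -, -, hrg⟩ := letters_ramp hβ
  exact not_betaSignH_ramp hβ (h S hH hD hC (theorem2_typed_ramp hβ hH hD) _ (1 / 2) (1 / 2) (5 * (1 / 2) / (1 / 2)) 1
    (by norm_num) (by norm_num) (by norm_num) (by norm_num) (histLipschitz_ramp hβ (by norm_num))
    (fadingMemory_ramp (by norm_num) (by norm_num) (by norm_num)) hU (hrg hD))

end

end Summit.QuantumFields.BalabanUV.Beta.EriceFlowEnclosureB12AsPrintedPointwiseFadingSignWitness
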